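import Summits.Ventures.YMGap.RobustBall.LocalSourceWilson
import Summits.Ventures.YMGap.RobustBall.LocalSourceAnalytic
import Summits.Ventures.YMGap.RobustBall.LocalSourceGaugeBall
import Summits.Ventures.YMGap.RobustBall.LocalSourceLoopBall
import Summits.Ventures.YMGap.RobustBall.KernelClusteringBall
import Summits.Ventures.YMGap.RobustBall.LangevinPoincare
import Summits.Ventures.YMGap.RobustBall.LangevinPoincareCells
import Summits.Ventures.YMGap.RobustBall.LangevinPoincareBall
import Summits.Ventures.YMGap.RobustBall.LangevinPoincareZd
import Summits.Ventures.YMGap.RobustBall.HeatBathPoincareBall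
import HarnessLib

/-!
# Venture statement — YMGap (cell `pub-ymgap`) — CONJUNCT BODIES T84 (= T84a–e), T85 (= T85a–c), T86 (= T86a–f) (V23H, block 1)

STATUS: FILED by p3 g12 (candidate staged by p3 g11) as V23H = T84 (= T84a–e) + T85 (= T85a–c) + T86 (= T86a–f) on the chair's ★ R372 (lead g13, bus 2026-08-25T04:42:58Z,
INBOX l.7648), quoted: «R372 = V23H BOOKING YES, same shape as V23E∕F∕G (R322∕R324∕R347∕R349∕R362 pattern): composition T84 (rb-p1 g7 «local source» texts
00370a5ff330cb9f) + T85 (ds-3 g14 part A) + T86 (rb-p2 g13 texts ea954f28b561199d) may GROW until your FINAL-sha line; owner windows to 05:40Z, silence = consent; referee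
pre-audit (mono + bytecmp + parents re-hash) on the FINAL bytes; then ONE dry-run ≤ 1∕20 min, ONE `--kind definition --review` filing on its ACCEPT, ONE wait; … index
numbering order of record on the next COMBINED append: T72–T74 (V23D) → T82–T83 (V23G) → T84–T86 (V23H), filed as the oleans allow». Owner words: rb-p1 g11 CONFIRM
l.7655; ds-3 (g17) / rb-p2 (g14): no correction by 05:40Z (silence = consent). Referee g37 pre-audit: F-728 (candidate) + F-731 (first final 715c9b6b6e924a62) + the
re-diff of THIS final asked on the bus before the filing. Composition frozen = T84 + T85 + T86 (engine-2's every-N set, GREEN l.7479, does not fit the 400-line budget and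
opens the next block V23I as T87); this FINAL differs from the candidate aa46564a036642c2 in this STATUS sentence, ONE re-worded header phrase (witness-rename remark) and
FIVE added one-line docstrings on rb-p1's `T84a–e_…_holds` (gate `lint.docstring`, dry-run 05:50Z) — comments only; statements, proofs and decl lines identical. Numbers
T84, T85, T86 assigned by p3 under lead g10's delegation (bus 2026-08-24T09:03:51Z «T-numbers (T71+) are p3's to assign»; ★ R322 (4) / ★ R324 (4); lead g13 R362 / R368
(C): «a set GREEN after the V23G final-sha line goes to the next block») in GREEN order = order of the owners' READY lines, announced on the bus before filing. GREEN =
parents are TREE modules with built oleans and the owner file answers a by-import `lean check` rc 0 / 0 warnings / std axioms: T84 — rb-p1 g7 «local source» texts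
O/P/S/Q/R `HOME/lean/v23-prestage-p3/owners/T-texts-rbp1g7-OPSQR.lean` 00370a5ff330cb9f (owner line bus l.5141, 2026-08-24; parents `RobustBall/LocalSourceWilson` p391405
681ad7007394 (tree f3cef8dc3cbd, olean 04:06Z 2026-08-25), `LocalSourceAnalytic` p383009 174e9e282e5e (ddcef407f871, 00:27Z), `LocalSourceGaugeBall` p392046 677af0f50e38
(ebaafc0f8960, 04:25Z), `LocalSourceLoopBall` p391820 2e3134f2f892 (392896a1f34a, 04:24Z)) rc 0 at 04:37Z; T85 — ds-3 g14 part A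
`HOME/ds/ds3/lean/g14/texts/V1XConjunctsDS3g14.lean` 946216aa22318df5 (owner line bus l.5842; parent `RobustBall/KernelClusteringBall` p381897 a130e66586b6 (913f442f3443,
olean 04:01Z)) rc 0 at 04:37Z; T86 — rb-p2 g13 `HOME/rb/lean-rb-p2/T-texts-rbp2g13.lean` ea954f28b561199d (owner line bus l.7036 «numbering ∕ naming yours»; parents
`RobustBall/LangevinPoincare` p387902 f51c90459391 (dd1023ad11c6, olean 02:33Z), `LangevinPoincareCells` p391167 ff78b39bd3cc (c325fed8cf73, 04:03Z),
`LangevinPoincareBall` p391603 aa356e06bc06 (7fcdfaf89145, 04:06Z), `LangevinPoincareZd` p391811 2e3134f2f892 (3daa0ab9f619, 04:24Z), `HeatBathPoincareBall` p388023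
60b046a76902 (babcdd2509c3, 02:33Z)) rc 0 at 04:37Z. Only decl names change (map `RENAMES-V23H.txt`: `T_X ↦ T84x_X` / `T85x_X` / `T86x_X` with p3's consolidating
conjunctions `T84_LocalSourceResponseAndMassGap`, `T85_KernelClusteringDobrushin`, `T86_LangevinAndGlauberPoincare` in the V20B/V22/V23D style, not owner bytes; rb-p1's
short witness names (of the form `T_<letter>` + `_holds`, e.g. for text O) are mapped explicitly to the numbered `T84a_…_holds` … names); ONE line `open
Summit.Ventures.YMGap.RobustBall` is added in the rb-p1 section (the owner file declares inside `namespace …RobustBall.TTexts`, which the block format strips — the V23E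
precedent) and FIVE one-line docstrings are added above rb-p1's `_holds` witnesses, which the owner file leaves undocumented (gate `lint.docstring`, dry-run 05:50Z;
statements and proofs untouched; `adddocs.py`); built mechanically by `mkmono23h.py` (= p2 g11's `mkmono.py`); byte-compare `bytecmp.py --map` = verbatim-modulo-map. NOT
IN THIS BLOCK: the T87+ queue of `HOME/lean/STATEMENT-INDEX-0823.md` (next block V23I).

HONEST FRAMING. WHAT THIS IS: bodies `Tk_… : Prop` + witnesses `Tk_…_holds`, kernel-checked with NO hypothesis, closing by TREE constants only. STRONG-COUPLING
LATTICE statements. (T84) THE LOCAL-SOURCE PACKAGE: (a) Feynman–Hellmann + real-analyticity of every `SU(N)` DLR selection in the strength `t` of ONE inserted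
loop `t·Re tr U_w/N`, 't Hooft `0 < β < 1/64`; (b) a MASS GAP (exponential clustering of Lipschitz cylinders) that survives one local source of ANY strength, with
an explicit rate and constant; (c) Le Chatelier monotonicity at the `SU(2)` Wilson point `0 ≤ β_W ≤ 1/3`; (d), (e) the same clustering uniformly on ds-2's all-`N`
gauge ball and on the loop ball — local couplings, finitely many terms; the rates are comparison lower bounds (door artefacts), not measured correlation lengths.
(T85) FINITE-VOLUME CLUSTERING UNIFORM IN THE VOLUME AND THE BOUNDARY FIELD: the generic kernel covariance estimate for ANY specification in Dobrushin's regime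
(Vasserstein form), the `SU(2)` `ℤ⁴` Wilson kernels at `0 ≤ β_W ≤ 1/12`, and the hypothesis-free tier-1-ball version — Kantorovich / Lipschitz-observable form, not
the total-variation form, not log-Sobolev. (T86) FUNCTIONAL INEQUALITIES OF THE DYNAMICS, `SU(2)`: the gradient-form (Langevin, carré-du-champ `Gam`) Poincaré
inequality uniformly in the volume on the Kantorovich–Rubinstein window `0 ≤ β_W < 2/9` (`d = 4`; `d = 3` on `β_W < 1/3`), on the torus ball at `β_W ≤ 1/8`, for every
finite-volume kernel with a frozen boundary field and for every infinite-volume limit state, and the Glauber (heat-bath) spectral gap `≥ 2/5` uniformly on the torus ball —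
lattice strong coupling; windows are where the one-link / Dobrushin bounds close; nothing about `β → ∞`, the crossover couplings, a continuum limit, a
physical-units mass gap or the Yang–Mills Millennium problem.
-/

noncomputable section

namespace Summit.Ventures.YMGap

/-! ### OWNER FILE `owners/T-texts-rbp1g7-OPSQR.lean` (sha16 00370a5ff330cb9f) — section `V23H_rbp1_LocalSource` -/
section V23H_rbp1_LocalSource

open Summit.Ventures.YMGap.RobustBall

/-!
# T-text CANDIDATES (rb-p1 g7) for p3 / the lead — the «local source» package, `SU(2)` on `ℤ⁴` and every `N ≥ 2`
(NOT a tree file; statement texts + `_holds` proofs; `T_M`/`T_N` are backed by LANDED files (LocalSourceOneState 8138d0beb6ad,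
LocalSourceOneStateS 8138d0beb6ad), `T_O`–`T_S` by STAGED files (LocalSourceResponseBall / LocalSourceAnalytic / LocalSourceWilson /
LocalSourceGaugeBall / LocalSourceLoopBall) — quotable only after those land.  Honest label: strong-coupling lattice statements about LOCAL couplings with finitely
many terms; rates are comparison lower bounds; nothing continuum / Clay.)
-/


open MeasureTheory Function Finset Real ProbabilityTheory
open scoped NNReal
open Literature.Probability.LatticeModels
open Literature.MathematicalPhysics.QuantumLattice
open Literature.MathematicalPhysics.QuantumFieldTheory hiding ZdEdge Site


/-- **T_O (FEYNMAN–HELLMANN + REAL-ANALYTICITY, every `N ≥ 2`, 't Hooft `0 < β < 1/64`)**: for every closed walk `w`, every selection `ν t` of DLR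
states of the `SU(N)` Wilson action with `t · Re tr U_w/N` inserted, and every bounded measurable `F`: `t ↦ ∫ F dν_t` has derivative
`−cov_{ν_b}(F, Re tr U_w/N)` at every `b` and is real-analytic at every `t₀`. -/
def T84a_LocalSourceResponseSUN : Prop :=
  ∀ (N : ℕ), 2 ≤ N → ∀ β : ℝ, 0 < β → β < 1 / 64 →
    ∀ (x : Literature.Probability.LatticeModels.Site 4) (w : (zdGraph 4).Walk x x) (ν : ℝ → Measure (LGConfig 4 (SUN N))),
    (∀ t, ν t ∈ perturbedGibbsMeasures (d := 4) (fundamentalRep (Fin N)) (N * β)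
      (loopFamilyAction N (fun _ : Unit => (⟨x, w⟩ : ZdLoop 4)) (fun _ => t)) (loopSupp (fun _ : Unit => (⟨x, w⟩ : ZdLoop 4)))) →
    ∀ (F : LGConfig 4 (SUN N) → ℝ), Measurable F → ∀ C : ℝ, (∀ U, |F U| ≤ C) →
      (∀ b : ℝ, HasDerivAt (fun t => ∫ U, F U ∂(ν t)) (-cov[F, loopTerm (d := 4) N 1 w; ν b]) b) ∧
      (∀ t₀ : ℝ, AnalyticAt ℝ (fun t => ∫ U, F U ∂(ν t)) t₀)

/-- `T84a_LocalSourceResponseSUN` holds — rb-p1 g7's witness (one-line docstring added by p3 for the gate's docstring lint; statement and proof are the owner's bytes). -/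
theorem T84a_LocalSourceResponseSUN_holds : T84a_LocalSourceResponseSUN := fun _ hN _ h0 h _ w _ hν _ hFm _ hFb =>
  ⟨fun b => suN_wilson_singleLoop_hasDerivAt hN h0 h w hν hFm hFb b,
    fun t₀ => suN_wilson_singleLoop_analyticAt hN h0 h w hν hFm hFb t₀⟩

/-- **T_P (THE MASS GAP SURVIVES ONE LOOP OF ANY STRENGTH, every `N ≥ 2`, 't Hooft `0 < β < 1/64`)**: every DLR state `ν` of the `SU(N)` Wilson
action with `t · Re tr U_w/N` inserted clusters between any two Lipschitz cylinders on disjoint link sets at rate `(1/2)log(1/(64β))`: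
`|cov_ν(F,G)| ≤ 8N n² e^{2|t|} e^{log(1/(64β))|w|} e^{−(log(1/(64β))/2) d(Λ_F,Λ_G)} (K_F K_G + 2(|t|√N|w|)(M_F K_G + M_G K_F) + 2 M_F M_G)`. -/
def T84b_LocalSourceMassGapSUN : Prop :=
  ∀ (N : ℕ), 2 ≤ N → ∀ β : ℝ, 0 < β → β < 1 / 64 →
    ∀ (x : Literature.Probability.LatticeModels.Site 4) (w : (zdGraph 4).Walk x x) (t : ℝ) (ν : Measure (LGConfig 4 (SUN N))),
    ν ∈ perturbedGibbsMeasures (d := 4) (fundamentalRep (Fin N)) (N * β)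
      (loopFamilyAction N (fun _ : Unit => (⟨x, w⟩ : ZdLoop 4)) (fun _ => t)) (loopSupp (fun _ : Unit => (⟨x, w⟩ : ZdLoop 4))) →
    ∀ (n : ℕ) (F G : LGConfig 4 (SUN N) → ℝ) (ΛF ΛG : Finset (ZdEdge 4)) (KF KG MF MG : ℝ≥0),
    IsLipschitzCylinder (fundamentalRep (Fin N)) F ΛF KF → (∀ U, |F U| ≤ MF) →
    IsLipschitzCylinder (fundamentalRep (Fin N)) G ΛG KG → (∀ U, |G U| ≤ MG) →
    (ΛF ∪ walkEdges w).card ≤ n → (ΛG ∪ walkEdges w).card ≤ n → Disjoint ΛF ΛG →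
      |cov[F, G; ν]| ≤ 8 * N * (n : ℝ) ^ 2 * exp (2 * |t|) * exp (Real.log (1 / (64 * β)) * (2 * w.length) / 2) *
          exp (-(Real.log (1 / (64 * β)) / 2) * setDistEdges ΛF ΛG) *
        ((KF : ℝ) * KG + 2 * (|t| * Real.sqrt N * w.length) * (MF * KG + MG * KF) + 2 * MF * MG)

/-- `T84b_LocalSourceMassGapSUN` holds — rb-p1 g7's witness (one-line docstring added by p3 for the gate's docstring lint; statement and proof are the owner's bytes). -/
theorem T84b_LocalSourceMassGapSUN_holds : T84b_LocalSourceMassGapSUN := fun _ hN _ h0 h _ w t _ hν _ _ _ _ _ _ _ _ _ hF hMF hG hMG hn₁ hn₂ hdisj =>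
  suN_wilson_singleLoop_massGap hN h0 h w t hν hF hMF hG hMG hn₁ hn₂ hdisj

/-- **T_S (LE CHATELIER at the `SU(2)` Wilson point, `0 ≤ β_W ≤ 1/3`)**: for every closed walk `w` and every selection `ν t` of DLR states of the
Wilson action with `t · Re tr U_w/2` inserted, `t ↦ ∫ Re tr U_w/2 dν_t` is non-increasing on `ℝ`. -/
def T84c_LocalSourceMonotone : Prop :=
  ∀ βW : ℝ, 0 ≤ βW → βW ≤ 1 / 3 → ∀ (x : Literature.Probability.LatticeModels.Site 4) (w : (zdGraph 4).Walk x x)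
    (ν : ℝ → Measure (LGConfig 4 (SUN 2))),
    (∀ t, ν t ∈ perturbedGibbsMeasures (d := 4) (fundamentalRep (Fin 2)) (2 * (βW / 4))
      (loopFamilyAction 2 (fun _ : Unit => (⟨x, w⟩ : ZdLoop 4)) (fun _ => t)) (loopSupp (fun _ : Unit => (⟨x, w⟩ : ZdLoop 4)))) →
      Antitone fun t => ∫ U, loopTerm (d := 4) 2 1 w U ∂(ν t)

/-- `T84c_LocalSourceMonotone` holds — rb-p1 g7's witness (one-line docstring added by p3 for the gate's docstring lint; statement and proof are the owner's bytes). -/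
theorem T84c_LocalSourceMonotone_holds : T84c_LocalSourceMonotone := fun _ h0 h1 _ w _ hν =>
  su2_wilson_singleLoop_expectation_antitone_upTo_oneThird h0 h1 w hν


/-- **T_Q (EVERY `N ≥ 2`, UNIFORMLY ON THE ALL-`N` GAUGE BALL — 't Hooft `|β| ≤ 1/64`, radii `(1/10, 1/20)`, any range `R`)**: for every member
`(W, supp)` of ds-2's gauge-invariant ball, every closed walk `w₀`, every real `t` and every DLR state `ν` of `W + t · Re tr U_{w₀}/N`:
clustering between any two Lipschitz cylinders on disjoint link sets at rate `((1/8)/max(1,R))/2` with constant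
`16N n² e^{2|t|} e^{((1/8)/max(1,R))|w₀|} (…)` — one more loop of any strength does not close the gap, uniformly on the ball. -/
def T84d_GaugeBallLocalSourceMassGapSUN : Prop :=
  ∀ (N : ℕ), 2 ≤ N → ∀ β : ℝ, |β| ≤ 1 / 64 → ∀ (R : ℕ) (W : Potential (ZdEdge 4) (SUN N))
    (supp : Finset (ZdEdge 4) → Finset (Finset (ZdEdge 4))), MemBallZdG (2 * (1 / 20)) (1 / 20) R W supp →
    ∀ (x : Literature.Probability.LatticeModels.Site 4) (w₀ : (zdGraph 4).Walk x x) (t : ℝ) (ν : Measure (LGConfig 4 (SUN N))),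
    ν ∈ perturbedGibbsMeasures (d := 4) (fundamentalRep (Fin N)) (N * β)
      (W + loopFamilyAction (d := 4) N (fun _ : Unit => (⟨x, w₀⟩ : ZdLoop 4)) (fun _ => t))
      (fun Λ => supp Λ ∪ loopSupp (fun _ : Unit => (⟨x, w₀⟩ : ZdLoop 4)) Λ) →
    ∀ (n : ℕ) (F G : LGConfig 4 (SUN N) → ℝ) (ΛF ΛG : Finset (ZdEdge 4)) (KF KG MF MG : ℝ≥0),
    IsLipschitzCylinder (fundamentalRep (Fin N)) F ΛF KF → (∀ U, |F U| ≤ MF) →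
    IsLipschitzCylinder (fundamentalRep (Fin N)) G ΛG KG → (∀ U, |G U| ≤ MG) →
    (ΛF ∪ walkEdges w₀).card ≤ n → (ΛG ∪ walkEdges w₀).card ≤ n → Disjoint ΛF ΛG →
      |cov[F, G; ν]| ≤ 16 * N * (n : ℝ) ^ 2 * exp (2 * |t|) * exp ((1 - 7 / 8) / max 1 (R : ℝ) * (2 * w₀.length) / 2) *
          exp (-((1 - 7 / 8) / max 1 (R : ℝ) / 2) * setDistEdges ΛF ΛG) *
        ((KF : ℝ) * KG + 2 * (|t| * Real.sqrt N * w₀.length) * (MF * KG + MG * KF) + 2 * MF * MG)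

/-- `T84d_GaugeBallLocalSourceMassGapSUN` holds — rb-p1 g7's witness (one-line docstring added by p3 for the gate's docstring lint; statement and proof are the owner's bytes). -/
theorem T84d_GaugeBallLocalSourceMassGapSUN_holds : T84d_GaugeBallLocalSourceMassGapSUN :=
  fun _ hN _ hβ _ _ _ hW _ w₀ t _ hν _ _ _ _ _ _ _ _ _ hF hMF hG hMG hn₁ hn₂ hdisj =>
    suN_ballZdG_singleLoop_massGap hN hβ hW w₀ t hν hF hMF hG hMG hn₁ hn₂ hdisj

/-- **T_R (EVERY `N ≥ 2`, UNIFORMLY ON THE LOOP BALL `‖c‖_{log(6/5)} ≤ 1/40` at 't Hooft `1/64`)**: for every generic loop action with finite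
fibres inside the ball, every closed walk `w₀`, every real `t` and every DLR state `ν` (summable specification) of the member plus
`t · Re tr U_{w₀}/N`: clustering at rate `(1/2)log(6/5)` with constant `8N n² e^{2|t|} (6/5)^{|w₀|} (…)`. -/
def T84e_LoopBallLocalSourceMassGapSUN : Prop :=
  ∀ (N : ℕ), 2 ≤ N → ∀ (ι : Type) (γ : ι → ZdLoop 4) (c : ι → ℝ), (∀ X, {i | walkEdges (γ i).walk = X}.Finite) →
    LoopNormLE (Real.log (6 / 5)) γ c (1 / 40) →
    ∀ (x : Literature.Probability.LatticeModels.Site 4) (w₀ : (zdGraph 4).Walk x x) (t : ℝ) (ν : Measure (LGConfig 4 (SUN N))),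
    ν ∈ perturbedGibbsMeasuresS (d := 4) (fundamentalRep (Fin N)) (N * (1 / 64 : ℝ))
      (loopFamilyAction (d := 4) N γ c + loopFamilyAction (d := 4) N (fun _ : Unit => (⟨x, w₀⟩ : ZdLoop 4)) (fun _ => t)) →
    ∀ (n : ℕ) (F G : LGConfig 4 (SUN N) → ℝ) (ΛF ΛG : Finset (ZdEdge 4)) (KF KG MF MG : ℝ≥0),
    IsLipschitzCylinder (fundamentalRep (Fin N)) F ΛF KF → (∀ U, |F U| ≤ MF) →
    IsLipschitzCylinder (fundamentalRep (Fin N)) G ΛG KG → (∀ U, |G U| ≤ MG) →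
    (ΛF ∪ walkEdges w₀).card ≤ n → (ΛG ∪ walkEdges w₀).card ≤ n → Disjoint ΛF ΛG →
      |cov[F, G; ν]| ≤ 8 * N * (n : ℝ) ^ 2 * exp (2 * |t|) * exp (Real.log (6 / 5) * (2 * w₀.length) / 2) *
          exp (-(Real.log (6 / 5) / 2) * setDistEdges ΛF ΛG) *
        ((KF : ℝ) * KG + 2 * (|t| * Real.sqrt N * w₀.length) * (MF * KG + MG * KF) + 2 * MF * MG)

/-- `T84e_LoopBallLocalSourceMassGapSUN` holds — rb-p1 g7's witness (one-line docstring added by p3 for the gate's docstring lint; statement and proof are the owner's bytes). -/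
theorem T84e_LoopBallLocalSourceMassGapSUN_holds : T84e_LoopBallLocalSourceMassGapSUN :=
  fun _ hN _ _ _ hfin hc _ w₀ t _ hν _ _ _ _ _ _ _ _ _ hF hMF hG hMG hn₁ hn₂ hdisj =>
    suN_loopBall_singleLoop_massGap hN hfin hc w₀ t hν hF hMF hG hMG hn₁ hn₂ hdisj



end V23H_rbp1_LocalSource

/-! ### OWNER FILE `owners/V1XConjunctsDS3g14.lean` (sha16 946216aa22318df5) — section `V23H_ds3_KernelClustering` -/
section V23H_ds3_KernelClustering

/-!
Statement v1.x candidate conjuncts from ds-3's gen-14 files (TEXT for the p2/p3 seats; checkable once `KernelClustering.lean`,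
`KernelClusteringBall.lean` are IN THE TREE (PART E carries the `KernelSusceptibility` text); NOT proposed by ds-3). Y2 ROBUST-BALL, currency C-KMIX:
FINITE-VOLUME CLUSTERING UNIFORM IN THE VOLUME AND THE BOUNDARY FIELD — the kernel covariance estimate for any specification in Dobrushin's
regime (generic), the clustering of the finite-volume Wilson distributions of `SU(2)` lattice Yang–Mills on `ℤ⁴` at `0 ≤ β_W ≤ 1/12` and
uniformly on the tier-1 ball, and the uniform energy-variance ceiling. HONEST LABEL: strong-coupling LATTICE statements inside the single-link
doors; Kantorovich / Lipschitz-observable form; not the total-variation form, not log-Sobolev; nothing continuum, nothing at the Y3 couplings.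
-/

open MeasureTheory Filter Topology ProbabilityTheory
open scoped NNReal
open Literature.Probability.LatticeModels hiding configShift configShift_apply
open Literature.MathematicalPhysics.QuantumLattice (fundamentalRep ZdEdge LGConfig ymSpecification ZdPlaquette plaquetteEdges)
open Literature.MathematicalPhysics.QuantumFieldTheory (IsLipschitzCylinder zdPlaquetteObs suFrobDist setDistEdges)
open Literature.Probability.LatticeModels.DobrushinMetric (IsLipBound IsKRContraction)
open Summit.Ventures.YMGap
open Summit.Ventures.YMGap.RobustBall

/-- **T85a_KernelCovarianceDobrushin — GENERIC**: for EVERY specification `γ` on EVERY configuration space `V → S` satisfying Dobrushin's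
condition in the Vasserstein form (`IsKRContraction γ r nbr C`, `0 ≤ r ≤ R`) with row sums `≤ c < 1` on a finite volume `Λ`: for EVERY
boundary condition `η`, bounded measurable local `f, g` (dependence sets `Δ_f, Δ_g`, Lipschitz vectors `δ_f, δ_g`) and every profile `ℓ`
vanishing on `Δ_g` with `ℓ x ≤ ℓ y + 1` (`x ∉ Δ_g`, `y ∈ nbr x`): `|cov_{γ_Λ(·|η)}(f, g)| ≤ 2R²(Σ_{y∈Δ_g} δ_g y)·Σ_{y∈Δ_f} c^{ℓ y} δ_f y`
(`KernelClustering.abs_covariance_kernel_le`). -/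
def T85a_KernelCovarianceDobrushin : Prop :=
  ∀ (V S : Type) [MeasurableSpace S] [DecidableEq V] (γ : Specification V S) (r : S → S → ℝ) (nbr : V → Finset V)
    (C : V → V → ℝ), IsSpecification γ → IsKRContraction γ r nbr C →
    ∀ R : ℝ, (∀ a b, 0 ≤ r a b) → (∀ a b, r a b ≤ R) → 0 ≤ R →
    ∀ c : ℝ, 0 ≤ c → c < 1 → ∀ Λ : Finset V, (∀ x ∈ Λ, ∑ y ∈ nbr x, C x y ≤ c) →
    ∀ (η : V → S) (f g : (V → S) → ℝ) (Δf Δg : Finset V) (Mf Mg : ℝ) (δf δg : V → ℝ),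
      Measurable f → DependsOn f (↑Δf : Set V) → (∀ σ, |f σ| ≤ Mf) → IsLipBound r f δf →
      Measurable g → DependsOn g (↑Δg : Set V) → (∀ σ, |g σ| ≤ Mg) → IsLipBound r g δg →
    ∀ ℓ : V → ℕ, (∀ y ∈ Δg, ℓ y = 0) → (∀ x ∉ Δg, ∀ y ∈ nbr x, ℓ x ≤ ℓ y + 1) →
      |cov[f, g; γ Λ η]| ≤ 2 * R ^ 2 * (∑ y ∈ Δg, δg y) * ∑ y ∈ Δf, c ^ ℓ y * δf y

/-- T85a_KernelCovarianceDobrushin holds. -/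
theorem T85a_KernelCovarianceDobrushin_holds : T85a_KernelCovarianceDobrushin :=
  fun _ _ _ _ _ _ _ _ hγ hC _ hr0 hrR hR _ hc0 hc1 Λ hrow η _ _ _ _ _ _ _ _ hfm hfdep hMf hδf hgm hgdep hMg hδg ℓ hℓ0 hℓ =>
    KernelClustering.abs_covariance_kernel_le hγ hC hr0 hrR hR hc0 hc1 Λ hrow η hfm hfdep hMf hδf hgm hgdep hMg hδg ℓ hℓ0 hℓ

/-- **T85b_SU2WilsonKernelClustering — `SU(2)` LATTICE YANG–MILLS ON `ℤ⁴`, `0 ≤ β_W ≤ 1/12`** (tree coupling `β_W/2`): for EVERY finite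
link volume `Λ`, EVERY boundary field `η` and all Lipschitz cylinders `F₁` (links `Λ₁`, constant `K₁`), `F₂` (links `Λ₂`, constant `K₂`):
`|cov_{γ_Λ(·|η)}(F₁, F₂)| ≤ 32 · #Λ₁ · #Λ₂ · K₁K₂ · e^{−(log 2)·d(Λ₁,Λ₂)}` — exponential clustering of the finite-volume Wilson distributions at
rate `log 2` per lattice unit, uniformly in the volume and the boundary field (`RobustBall.su2_wilson_kernel_clustering_upTo_oneTwelfth`). -/
def T85b_SU2WilsonKernelClustering : Prop :=
  ∀ βW : ℝ, 0 ≤ βW → βW ≤ 1 / 12 →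
    ∀ (Λ : Finset (ZdEdge 4)) (η : LGConfig 4 (Matrix.specialUnitaryGroup (Fin 2) ℂ))
      (F₁ F₂ : LGConfig 4 (Matrix.specialUnitaryGroup (Fin 2) ℂ) → ℝ) (Λ₁ Λ₂ : Finset (ZdEdge 4)) (K₁ K₂ : ℝ≥0),
      IsLipschitzCylinder (fundamentalRep (Fin 2)) F₁ Λ₁ K₁ → IsLipschitzCylinder (fundamentalRep (Fin 2)) F₂ Λ₂ K₂ →
      |cov[F₁, F₂; ymSpecification (d := 4) (fundamentalRep (Fin 2)) (βW / 2) Λ η]| ≤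
        32 * Λ₁.card * Λ₂.card * ((K₁ : ℝ) * K₂) * Real.exp (-Real.log 2 * setDistEdges Λ₁ Λ₂)

/-- T85b_SU2WilsonKernelClustering holds. -/
theorem T85b_SU2WilsonKernelClustering_holds : T85b_SU2WilsonKernelClustering :=
  fun _ h0 h Λ η _ _ _ _ _ _ hF₁ hF₂ => su2_wilson_kernel_clustering_upTo_oneTwelfth h0 h Λ η hF₁ hF₂

/-- **T85c_SU2BallKernelClustering — `SU(2)`, `ℤ⁴`, HYPOTHESIS-FREE, UNIFORMLY ON THE TIER-1 BALL**: `6|β_W| e^{ε₀} + e^{ε₀/2}√(2/3) ε₁ ≤ ρ < 1`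
⇒ for every member of `MemBallZd ε₀ ε₁ R`, EVERY finite link volume, EVERY boundary field and Lipschitz cylinders `F₁, F₂`:
`|cov_{γ^W_Λ(·|η)}(F₁, F₂)| ≤ 16 · #Λ₁ · #Λ₂ · K₁K₂ · e^{κ} · e^{−(κ/max(1,R))·d(Λ₁,Λ₂)}`, `κ = −log max(ρ,½)`
(`RobustBall.su2_kernel_covariance_decay_dim4`). -/
def T85c_SU2BallKernelClustering : Prop :=
  ∀ βW ε₀ ε₁ ρ R : ℝ, 6 * |βW| * Real.exp ε₀ + Real.exp (ε₀ / 2) * Real.sqrt (2 / 3) * ε₁ ≤ ρ → ρ < 1 →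
    ∀ (W : Potential (ZdEdge 4) (Matrix.specialUnitaryGroup (Fin 2) ℂ))
      (supp : Finset (ZdEdge 4) → Finset (Finset (ZdEdge 4))), MemBallZd ε₀ ε₁ R W supp →
    ∀ (Λ : Finset (ZdEdge 4)) (η : LGConfig 4 (Matrix.specialUnitaryGroup (Fin 2) ℂ))
      (F₁ F₂ : LGConfig 4 (Matrix.specialUnitaryGroup (Fin 2) ℂ) → ℝ) (Λ₁ Λ₂ : Finset (ZdEdge 4)) (K₁ K₂ : ℝ≥0),
      IsLipschitzCylinder (fundamentalRep (Fin 2)) F₁ Λ₁ K₁ → IsLipschitzCylinder (fundamentalRep (Fin 2)) F₂ Λ₂ K₂ →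
      |cov[F₁, F₂; perturbedYM (d := 4) (fundamentalRep (Fin 2)) ((2 : ℕ) * (βW / 4)) W supp Λ η]| ≤
        16 * Λ₁.card * Λ₂.card * ((K₁ : ℝ) * K₂) *
          (Real.exp (-Real.log (max ρ (1 / 2))) * Real.exp (-(-Real.log (max ρ (1 / 2)) / max 1 R) * setDistEdges Λ₁ Λ₂))

/-- T85c_SU2BallKernelClustering holds. -/
theorem T85c_SU2BallKernelClustering_holds : T85c_SU2BallKernelClustering :=
  fun _ _ _ _ _ hρ hρ1 _ _ hmem Λ η _ _ _ _ _ _ hF₁ hF₂ => su2_kernel_covariance_decay_dim4 hρ hρ1 hmem Λ η hF₁ hF₂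

end V23H_ds3_KernelClustering

/-! ### OWNER FILE `owners/T-texts-rbp2g13.lean` (sha16 ea954f28b561199d) — section `V23H_rbp2_LangevinPoincare` -/
section V23H_rbp2_LangevinPoincare

/-!
# Venture YMGap — candidate statement conjuncts (T-texts) for rb-p2 g13's landings (p3 numbers / renames)

HONEST FRAMING: universal closures, VERBATIM over tree theorems (two IN THE TREE, the rest STAGED behind oleans at the time of writing), of the
LANGEVIN (gradient-form, `LatticeBakryEmery.Gam`) and GLAUBER (heat-bath) Poincaré inequalities of strong-coupling 4D `SU(2)` lattice Yang–Mills on the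
Kantorovich–Rubinstein window `0 ≤ β_W < 2/9` (Bakry–Émery: `1/12` SZZ, `1/8` venture), uniformly in the volume, the boundary field and — for the ball rows —
the member.  LATTICE statements at strong coupling; nothing about `β → ∞`, the continuum or Clay.  Each `_holds` closes by tree constants only.  DRAFT for
p3 / rb-theory (naming and numbering are theirs); not proposed by rb-p2.
-/


open scoped ContDiff Matrix.Norms.Frobenius
open MeasureTheory ProbabilityTheory Function Finset
open Literature.MathematicalPhysics.QuantumLattice hiding torusNorm
open Literature.MathematicalPhysics.QuantumFieldTheory hiding ZdEdge
open Literature.MathematicalPhysics.QuantumFieldTheory.Balaban1983to89.StrongCouplingTorusWindow (wilsonPlaqWeight)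
open Summit.Ventures.YMGap.LatticeBakryEmery


/-- CANDIDATE T-text ★★★ «LANGEVIN POINCARÉ INEQUALITY UNIFORMLY IN THE VOLUME, SU(2), d = 4, every `0 ≤ β_W < 2/9`» (IN THE TREE:
`RobustBall.LangevinPoincare.su2_variance_le_integral_Gam`): on every torus of side `≥ 2`, for every smooth `f` of the link matrices,
`Var_μ(f) ≤ ((1 − 9β_W/2)(1 − 3β_W))⁻¹ ∫ Γ(f,f) dμ`. [folklore] -/
def T86a_SU2LangevinPoincareKR : Prop :=
  ∀ βW : ℝ, 0 ≤ βW → βW < 2 / 9 → ∀ (L : ℕ) [NeZero L], 1 < L → ∀ f : Cfg (Edge 4 L) 2 → ℝ, ContDiff ℝ ∞ f →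
    Var[fun U => f (emb U); wilsonMeasure (d := 4) (L := L) (fundamentalRep (Fin 2)) (βW / 2)] ≤
      ((1 - 9 * βW / 2) * (1 - 3 * βW))⁻¹ * ∫ U, Gam f f (emb U) ∂(wilsonMeasure (d := 4) (L := L) (fundamentalRep (Fin 2)) (βW / 2))

/-- `T86a_SU2LangevinPoincareKR` holds. [folklore] -/
theorem T86a_SU2LangevinPoincareKR_holds : T86a_SU2LangevinPoincareKR := fun _ h0 h _ _ hL _ hf =>
  RobustBall.LangevinPoincare.su2_variance_le_integral_Gam h0 h hL hf

/-- CANDIDATE T-text ★★ «GLAUBER (HEAT-BATH) SPECTRAL GAP ≥ 2/5 UNIFORMLY ON THE TORUS BALL, SU(2), d = 4, every `0 ≤ β_W ≤ 1/8`» (IN THE TREE: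
`RobustBall.HeatBathPoincareBall.su2_heatBathPoincare_onBall_oneEighth`): for every member with per-link loads `(a, ℓ_s, column Λ) ≤ (1/100, 1/500, 1/500)`,
every torus of side `≥ 2` and every bounded measurable `F`, `Var_{μ_W}(F) ≤ (5/4) ∑_ℓ ∫∫ (F − F∘[ℓ ↦ g])² dν^W_ℓ dμ_W`. [folklore] -/
def T86b_SU2GlauberGapOnBall : Prop :=
  ∀ βW : ℝ, 0 ≤ βW → βW ≤ 1 / 8 → ∀ (L : ℕ) [NeZero L], 1 < L → ∀ (W : RobustBall.Perturbation 4 L 2) (w : RobustBall.LoadWitness W),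
    (∀ e, w.oscLoad 0 e ≤ 1 / 100) → (∀ e, w.selfLipLoad 0 e ≤ 1 / 500) → (∀ y, ∑ e ∈ univ.erase y, w.crossLip 0 e y ≤ 1 / 500) →
    ∀ F : GaugeConfig 4 L (RobustBall.SUN 2) → ℝ, Measurable F → (∃ M : ℝ, ∀ U, |F U| ≤ M) →
      variance F (W.perturbedMeasure (fundamentalRep (Fin 2)) (βW / 2)) ≤
        (5 / 4 : ℝ) * ∑ ℓ : Edge 4 L, ∫ U, ∫ g, (F U - F (update U ℓ g)) ^ 2
          ∂((haarProbability (RobustBall.SUN 2)).tilted fun g' =>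
              torusLogWeight (wilsonPlaqWeight 2 (βW / 2)) (update U ℓ g') - W.total (update U ℓ g'))
          ∂(W.perturbedMeasure (fundamentalRep (Fin 2)) (βW / 2))

/-- `T86b_SU2GlauberGapOnBall` holds. [folklore] -/
theorem T86b_SU2GlauberGapOnBall_holds : T86b_SU2GlauberGapOnBall := fun _ h0 h8 _ _ hL _ w ha hs hcol F hF hFb =>
  RobustBall.HeatBathPoincareBall.su2_heatBathPoincare_onBall_oneEighth h0 h8 hL w ha hs hcol F hF hFb

/-- CANDIDATE T-text ★★ «LANGEVIN POINCARÉ INEQUALITY UNIFORMLY ON THE TORUS BALL, SU(2), d = 4, every `0 ≤ β_W ≤ 1/8`» (STAGED: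
`RobustBall.LangevinPoincare.su2_variance_le_integral_Gam_onBall_oneEighth`): for every member with per-link loads `(a, ℓ_s, column Λ) ≤ (1/100, 1/500, 1/500)`,
every torus of side `≥ 2` and every smooth `f`, `Var_{μ_W}(f) ≤ (65/16) ∫ Γ(f,f) dμ_W`. [folklore] -/
def T86c_SU2LangevinPoincareOnBall : Prop :=
  ∀ βW : ℝ, 0 ≤ βW → βW ≤ 1 / 8 → ∀ (L : ℕ) [NeZero L], 1 < L → ∀ (W : RobustBall.Perturbation 4 L 2) (w : RobustBall.LoadWitness W),
    (∀ e, w.oscLoad 0 e ≤ 1 / 100) → (∀ e, w.selfLipLoad 0 e ≤ 1 / 500) → (∀ y, ∑ e ∈ univ.erase y, w.crossLip 0 e y ≤ 1 / 500) →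
    ∀ f : Cfg (Edge 4 L) 2 → ℝ, ContDiff ℝ ∞ f →
      Var[fun U => f (emb U); W.perturbedMeasure (fundamentalRep (Fin 2)) (βW / 2)] ≤
        (65 / 16 : ℝ) * ∫ U, Gam f f (emb U) ∂(W.perturbedMeasure (fundamentalRep (Fin 2)) (βW / 2))

/-- `T86c_SU2LangevinPoincareOnBall` holds. [folklore] -/
theorem T86c_SU2LangevinPoincareOnBall_holds : T86c_SU2LangevinPoincareOnBall := fun _ h0 h8 _ _ hL _ w ha hs hcol _ hf =>
  RobustBall.LangevinPoincare.su2_variance_le_integral_Gam_onBall_oneEighth h0 h8 hL w ha hs hcol hf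

/-- CANDIDATE T-text ★★★ «UNIFORM KERNEL POINCARÉ INEQUALITY ON ℤ⁴, SU(2), every `0 ≤ β_W < 2/9`» (STAGED: `RobustBall.LangevinPoincare.su2_uniformKernelPoincareGrad`):
`UniformKernelPoincareGrad 4 2 (β_W/4) ((1 − 9β_W/2)(1 − 3β_W))` — every finite volume, every boundary field. [folklore] -/
def T86d_SU2UniformKernelPoincareKR : Prop :=
  ∀ βW : ℝ, 0 ≤ βW → βW < 2 / 9 → LatticeBakryEmery.UniformKernelPoincareGrad 4 2 (βW / 4) ((1 - 9 * βW / 2) * (1 - 3 * βW))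

/-- `T86d_SU2UniformKernelPoincareKR` holds. [folklore] -/
theorem T86d_SU2UniformKernelPoincareKR_holds : T86d_SU2UniformKernelPoincareKR := fun _ h0 h =>
  RobustBall.LangevinPoincare.su2_uniformKernelPoincareGrad h0 h

/-- CANDIDATE T-text ★★★ «POINCARÉ INEQUALITY OF EVERY INFINITE-VOLUME LIMIT STATE, SU(2), d = 4, every `0 ≤ β_W < 2/9`» (STAGED:
`RobustBall.LangevinPoincare.su2_limit_variance_le_sum_sq`): for every tight limit `μ` of the torus states and every smooth cylinder function that is
`L_e`-Lipschitz in the link `e`, `Var_μ(F) ≤ ((1 − 9β_W/2)(1 − 3β_W))⁻¹ ∑_e L_e²` (Shen–Zhu–Zhu Cor. 4.5 variance clause on the KR window). [folklore] -/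
def T86e_SU2LimitStatePoincareKR : Prop :=
  ∀ βW : ℝ, 0 ≤ βW → βW < 2 / 9 →
    ∀ μ : Measure (LGConfig 4 (Matrix.specialUnitaryGroup (Fin 2) ℂ)), μ ∈ infiniteVolumeLimitPoints (d := 4) (fundamentalRep (Fin 2)) (βW / 2) →
    ∀ (Λ : Finset (Literature.MathematicalPhysics.QuantumFieldTheory.ZdEdge 4)) (f : (↥Λ → Matrix (Fin 2) (Fin 2) ℂ) → ℝ) (Lc : ↥Λ → ℝ),
      ContDiff ℝ ∞ f → (∀ e, 0 ≤ Lc e) →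
      (∀ (e : ↥Λ) (M M' : ↥Λ → Matrix.specialUnitaryGroup (Fin 2) ℂ), (∀ e', e' ≠ e → M e' = M' e') →
        |f (fun e' => (M e' : Matrix (Fin 2) (Fin 2) ℂ)) - f (fun e' => (M' e' : Matrix (Fin 2) (Fin 2) ℂ))| ≤ Lc e * suFrobDist (M e) (M' e)) →
      Var[matrixCylinder Λ f; μ] ≤ ((1 - 9 * βW / 2) * (1 - 3 * βW))⁻¹ * ∑ e, Lc e ^ 2

/-- `T86e_SU2LimitStatePoincareKR` holds. [folklore] -/
theorem T86e_SU2LimitStatePoincareKR_holds : T86e_SU2LimitStatePoincareKR := fun _ h0 h _ hμ Λ f Lc hf hL hLip =>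
  RobustBall.LangevinPoincare.su2_limit_variance_le_sum_sq h0 h hμ Λ f Lc hf hL hLip

/-- CANDIDATE T-text ★★ «LANGEVIN POINCARÉ INEQUALITY, SU(2), d = 3, every `0 ≤ β_W < 1/3`» (STAGED: `RobustBall.LangevinPoincare.su2_variance_le_integral_Gam_dim3`):
on every torus `(ℤ/L)³`, `L ≥ 2`, `Var_μ(f) ≤ ((1 − 3β_W)(1 − 2β_W))⁻¹ ∫ Γ(f,f) dμ` (Bakry–Émery window in `d = 3`: `β_W < 1/6`). [folklore] -/
def T86f_SU2LangevinPoincareDim3 : Prop :=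
  ∀ βW : ℝ, 0 ≤ βW → βW < 1 / 3 → ∀ (L : ℕ) [NeZero L], 1 < L → ∀ f : Cfg (Edge 3 L) 2 → ℝ, ContDiff ℝ ∞ f →
    Var[fun U => f (emb U); wilsonMeasure (d := 3) (L := L) (fundamentalRep (Fin 2)) (βW / 2)] ≤
      ((1 - 3 * βW) * (1 - 2 * βW))⁻¹ * ∫ U, Gam f f (emb U) ∂(wilsonMeasure (d := 3) (L := L) (fundamentalRep (Fin 2)) (βW / 2))

/-- `T86f_SU2LangevinPoincareDim3` holds. [folklore] -/
theorem T86f_SU2LangevinPoincareDim3_holds : T86f_SU2LangevinPoincareDim3 := fun _ h0 h _ _ hL _ hf =>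
  RobustBall.LangevinPoincare.su2_variance_le_integral_Gam_dim3 h0 h hL hf



end V23H_rbp2_LangevinPoincare

/-! ### DEFAULT GROUPING (p2): one consolidating conjunction per owner file — `G_<tag> := T_a ∧ T_b ∧ …` + `_holds`.
The lead composes V23H by theme; p3 renames `G_<tag> ↦ T<k>_<Name>` (via --map) or regroups at will; these are additions, not owner bytes. -/
section V23H_groups

/-- Default group for section `V23H_rbp1_LocalSource`: the conjunction of its 5 owner texts. -/
def T84_LocalSourceResponseAndMassGap : Prop :=
  T84a_LocalSourceResponseSUN ∧ T84b_LocalSourceMassGapSUN ∧ T84c_LocalSourceMonotone ∧ T84d_GaugeBallLocalSourceMassGapSUN ∧ T84e_LoopBallLocalSourceMassGapSUN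

/-- `T84_LocalSourceResponseAndMassGap` holds (componentwise by the owners' `_holds`). -/
theorem T84_LocalSourceResponseAndMassGap_holds : T84_LocalSourceResponseAndMassGap :=
  ⟨T84a_LocalSourceResponseSUN_holds, T84b_LocalSourceMassGapSUN_holds, T84c_LocalSourceMonotone_holds, T84d_GaugeBallLocalSourceMassGapSUN_holds, T84e_LoopBallLocalSourceMassGapSUN_holds⟩

/-- Default group for section `V23H_ds3_KernelClustering`: the conjunction of its 3 owner texts. -/
def T85_KernelClusteringDobrushin : Prop :=
  T85a_KernelCovarianceDobrushin ∧ T85b_SU2WilsonKernelClustering ∧ T85c_SU2BallKernelClustering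

/-- `T85_KernelClusteringDobrushin` holds (componentwise by the owners' `_holds`). -/
theorem T85_KernelClusteringDobrushin_holds : T85_KernelClusteringDobrushin :=
  ⟨T85a_KernelCovarianceDobrushin_holds, T85b_SU2WilsonKernelClustering_holds, T85c_SU2BallKernelClustering_holds⟩

/-- Default group for section `V23H_rbp2_LangevinPoincare`: the conjunction of its 6 owner texts. -/
def T86_LangevinAndGlauberPoincare : Prop :=
  T86a_SU2LangevinPoincareKR ∧ T86b_SU2GlauberGapOnBall ∧ T86c_SU2LangevinPoincareOnBall ∧ T86d_SU2UniformKernelPoincareKR ∧ T86e_SU2LimitStatePoincareKR ∧ T86f_SU2LangevinPoincareDim3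

/-- `T86_LangevinAndGlauberPoincare` holds (componentwise by the owners' `_holds`). -/
theorem T86_LangevinAndGlauberPoincare_holds : T86_LangevinAndGlauberPoincare :=
  ⟨T86a_SU2LangevinPoincareKR_holds, T86b_SU2GlauberGapOnBall_holds, T86c_SU2LangevinPoincareOnBall_holds, T86d_SU2UniformKernelPoincareKR_holds, T86e_SU2LimitStatePoincareKR_holds, T86f_SU2LangevinPoincareDim3_holds⟩

end V23H_groups

end Summit.Ventures.YMGap

end
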